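import Literature.NumberTheory.EllipticCurves.Kato2004.OrdinaryKernelFunctionalOfQuotientRankProofs
import Literature.NumberTheory.EllipticCurves.Kato2004.LocalIwasawaCohomologyPoitouTateProofs
import Literature.NumberTheory.EllipticCurves.Kato2004.IwasawaH1ProjZeroKernelProofs
import Literature.NumberTheory.EllipticCurves.Kato2004.IwasawaCohomologyExistsProofs
import Literature.NumberTheory.EllipticCurves.IwasawaSelmerModuleFiniteProofs
import Literature.NumberTheory.EllipticCurves.IwasawaDualInvolSemilinearTransposeProofs
import Literature.NumberTheory.EllipticCurves.TateModuleFreeProofs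
import HarnessLib

/-!
# The ordinary-kernel functional WITHOUT (12.2.3): `exists_ordinaryKernelFunctional` (p727215) is a THEOREM modulo Poitou–Tate
# exactness (p729889) + «the ordinary quotient is torsion-free of rank one» (p740652) — the ordinary quotient
# `𝐇¹_{loc,Γ}(T_pW) ⧸ 𝐇¹_{loc,Γ}(F⁺T_pW)` is FINITELY GENERATED because the coarse quotient embeds `ι`-semilinearly into `X(E/ℚ_∞)` — proofs only

Topic `NumberTheory/EllipticCurves/Kato2004` (namespace = path).  Width seat `cruxlead-stmt-BirchSwinnertonDyer-19573-w3` g10 (cell `pub/bsd-2adic`;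
crux `OrdKatoHalfAtTwoIso` = item 19573 of `Summits/BirchSwinnertonDyer`, K4 child 24097, line `steinberg-fibre-at-two`, cite stub
`stub_ordKernelFunctional : exists_ordinaryKernelFunctional`).  Sibling of `OrdinaryKernelFunctionalOfQuotientRankProofs.lean` (w3 g8, p741408), which
derived the cite stub from the structure fact `localIwasawaH1_ordinaryQuotient_isTorsionFree_rank_eq_one` (hQ, p740652) AND the finite-generation fact
(12.2.3) `localIwasawaH1_tateRep_moduleFinite` (audit: XL, no owner).  THIS FILE removes (12.2.3): the rank-one algebra needs finite generation of the
QUOTIENT `Q = 𝐇¹_{loc,Γ}(T) ⧸ range(𝐇¹_{loc,Γ}(F⁺T))` only, which follows from Poitou–Tate exactness (clause (E) of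
`exists_lambdaAdicLocalTatePairing_poitouTate_exact`, p729889, every `p`) and two KERNEL theorems — finite generation of `X(E/ℚ_∞)`
(`SelmerDualData.module_finite_holds`, Greenberg p. 60) and of `𝐇¹_Γ(T_pW)` ((12.2.1), `IwasawaH1Data.module_finite_of_isCyclotomic`): along Kato's
(17.13.1) `𝐇¹_Γ(T) → 𝐇¹_{loc,Γ}(T)/𝐇¹_{loc,Γ}(F⁺T) → X(E/ℚ_∞) → X₀(E/ℚ_∞) → 0`, the transpose of the `Λ`-adic local Tate pairing is an `ι`-SEMILINEAR
`F : 𝐇¹_{loc,Γ}(T) → X(E/ℚ_∞)` (`ι : X ↦ (1+X)⁻¹ − 1`; the pairing is keyed by `γ⁻¹` on the discrete side) with kernel EXACTLY `range(F⁺) + loc_v 𝐇¹_Γ(T)`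
((E) ⊆, (I)(R) ⊇), so `Q` is an extension of a module embedding semilinearly into the Noetherian `X(E/ℚ_∞)` by an image of `𝐇¹_Γ(T)`.  Mirror, for
crux 19573, of the LEAD 19556 g10 finding «(12.2.3) REDUNDANT in 4‴» (there through Nekovář's `δ`; here through Kato's own sequence over `ℚ`).

## What is proved (no definition, no named fact, no instance, no notation; everything a theorem)
§1 the g8 rank-one algebra with `Module.Finite Λ M` weakened to `Module.Finite Λ (M ⧸ N)` (same proofs): `exists_functional_ker_eq_…_of_moduleFinite_quotient`,
  `notMem_augIdealP_iff_of_normalised_of_moduleFinite_quotient`, `notMem_augIdealP_iff_of_ker_le_of_moduleFinite_quotient`.  (The transpose from a weak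
  source and «`M ⧸ ker F` finitely generated» are the generic file `IwasawaDualInvolSemilinearTransposeProofs.lean`, same seat.)
§2 ON KATO'S CARRIERS (every `p`; `W/ℚ` globally minimal, good ordinary at `p`; `κ` cyclotomic; pins `I`, `J`, `J′`; `D` any Selmer dual datum):
* `exists_involSemilinear_transpose_ker_eq_of_poitouTate (hPT)` — an `ι`-semilinear `F : 𝐇¹_{loc,Γ}(T_pW) → X(E/ℚ_∞)` with
  `ker F = range(𝐇¹_{loc,Γ}(F⁺T) → 𝐇¹_{loc,Γ}(T)) ⊔ loc_v(𝐇¹_Γ(T_pW))`; `exists_injective_involSemilinear_coarseQuotient_of_poitouTate (hPT)` — the coarse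
  quotient EMBEDS `ι`-semilinearly into `X(E/ℚ_∞)` (the map `δ` of the four-term sequence);
* `moduleFinite_coarseQuotient_of_poitouTate`; **`moduleFinite_ordinaryQuotient_of_poitouTate (hPT)`: `Q` is finitely generated over `Λ`** in the
  binder list of the cite stub (no global pin, no `γ`, no structure instances) — what (12.2.3) was used for;
* **`exists_ordinaryKernelFunctional_of_poitouTate_of_ordinaryQuotientRank : hPT → hQ → exists_ordinaryKernelFunctional`** ((12.2.3) GONE);
  `exists_saturated_ordinaryKernelFunctional_…` (finite cokernel + saturation, the shape of Prop. 17.11); `ordinaryKernelFunctional_notMem_iff_…` ×2.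

HONEST FRAMING: the two hypotheses are NAMED FACTS (declared debt; audit-2 sheets hPTE / hOQR1 PASS); every §2 door is CONDITIONAL on them (signature).
NET: the binder set {hPT, hOK ⟸ (12.2.3) + hQ} of the `Δ < 0` doors of line `steinberg-fibre-at-two` becomes {hPT, hQ}.  Nothing about BSD is proved here.

## References
* [Kato2004Asterisque] Astérisque 295 (2004), §17.13 (17.13.1)–(17.13.2) (p. 279), Prop. 17.11 with proof (p. 277), §12.2 (12.2.1)/(12.2.3) (p. 220), 13.14 (p. 234).
* [GreenbergLNM1716] LNM 1716 (1999), §1 p. 60 (`X` finitely generated for every `p`), §4 pp. 121–122 (the sequence; «`G` and `G*` are orthogonal complements»).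
* [MilneADT2006] I Thm. 4.10; [Harari2020] Thm. 17.13 (c); [Lang1990] Ch. 5 §1; [MazurTateTeitelbaum1986Invent] Ch. I §17; [BourbakiAC5to7] VII §4 nos. 1–2;
  [PerrinRiou2000JAMS] §1.1; [SilvermanAEC2009] III.7.1.
-/

set_option autoImplicit false

noncomputable section

open scoped Classical NumberField
open Field IsDedekindDomain WeierstrassCurve
open Literature.NumberTheory.GaloisRepresentations
open Literature.NumberTheory.EllipticCurves Literature.NumberTheory.EllipticCurves.GreenbergSelmer
open Literature.NumberTheory.EllipticCurves.IwasawaDual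
open Literature.NumberTheory.EllipticCurves.Kato2004 Literature.NumberTheory.EllipticCurves.Kato2004.EulerSystemValues

namespace Literature.NumberTheory.EllipticCurves.Kato2004

/-! ## §1 The rank-one algebra with `Module.Finite Λ (M ⧸ N)` only -/

section FiniteGeneration

variable {p : ℕ} [Fact p.Prime]
variable {M : Type*} [AddCommGroup M] [Module (IwasawaAlgebra p) M]

/-- **The normalised exact-kernel functional from `Module.Finite Λ (M ⧸ N)` only** (w3 g8's `exists_functional_ker_eq_of_isTorsionFree_rank_eq_one`
with the finite generation of `M` weakened to that of the quotient — all its proof used): for `M ⧸ N` finitely generated, torsion-free of rank one,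
there is `col : M → Λ` with kernel EXACTLY `N`, a value outside `(p)`, range of FINITE index and SATURATED range.
[cite: BourbakiAC5to7, Ch. VII §4 nos. 1–2] [cite: Kato2004Asterisque, 13.14 (p. 234)] -/
theorem exists_functional_ker_eq_of_isTorsionFree_rank_eq_one_of_moduleFinite_quotient
    (N : Submodule (IwasawaAlgebra p) M) [Module.Finite (IwasawaAlgebra p) (M ⧸ N)]
    [Module.IsTorsionFree (IwasawaAlgebra p) (M ⧸ N)] (hrk : Module.rank (IwasawaAlgebra p) (M ⧸ N) = 1) :
    ∃ col : M →ₗ[IwasawaAlgebra p] IwasawaAlgebra p,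
      (∀ x : M, col x = 0 ↔ x ∈ N) ∧ (∃ x : M, col x ∉ IwasawaAlgebra.augIdealP p) ∧
        Finite (IwasawaAlgebra p ⧸ LinearMap.range col) ∧
        (∀ π : IwasawaAlgebra p, ¬ IsUnit π → ¬ (LinearMap.range col ≤ Ideal.span {π})) := by
  haveI : Nontrivial (M ⧸ N) := by
    by_contra hnt
    rw [not_nontrivial_iff_subsingleton] at hnt
    have h0 : Module.rank (IwasawaAlgebra p) (M ⧸ N) = 0 := rank_subsingleton' _ _
    rw [hrk] at h0
    exact one_ne_zero h0
  obtain ⟨φ₀, hφ₀⟩ :=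
    Module.exists_injective_linearMap_of_rank_le_one (R := IwasawaAlgebra p) (M := M ⧸ N) hrk.le
  obtain ⟨φ, hφ, hsat⟩ := IwasawaAlgebra.exists_injective_range_not_le_span φ₀ hφ₀
  have hrange : LinearMap.range (φ ∘ₗ N.mkQ) = LinearMap.range φ :=
    LinearMap.range_comp_of_range_eq_top _ (Submodule.range_mkQ N)
  have hne : LinearMap.range φ ≠ ⊥ := fun hbot =>
    hsat _ (IwasawaAlgebra.prime_C p).not_unit (hbot ▸ bot_le)
  refine ⟨φ ∘ₗ N.mkQ, fun x => ?_, ?_, ?_, fun π hπ => ?_⟩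
  · rw [LinearMap.comp_apply, map_eq_zero_iff φ hφ, Submodule.mkQ_apply, Submodule.Quotient.mk_eq_zero]
  · obtain ⟨y, hy, hyp⟩ := SetLike.not_le_iff_exists.mp (hsat _ (IwasawaAlgebra.prime_C p).not_unit)
    rw [← hrange] at hy
    obtain ⟨x, rfl⟩ := hy
    exact ⟨x, hyp⟩
  · rw [hrange]
    exact IwasawaAlgebra.finite_quotient_of_forall_not_le_span _ hne hsat
  · rw [hrange]
    exact hsat π hπ

/-- **Choice-freeness of «`μ`-free value» from `Module.Finite Λ (M ⧸ N)` only**: for `M ⧸ N` finitely generated, torsion-free of rank one,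
two functionals `ψ₁, ψ₂ : M → Λ` vanishing on `N`, each with SOME value outside `(p)`, and any `m`: `ψ₁ m ∉ (p) ↔ ψ₂ m ∉ (p)`.
[cite: BourbakiAC5to7, Ch. VII §4 no. 2] [cite: Washington1997, §13.1] -/
theorem notMem_augIdealP_iff_of_normalised_of_moduleFinite_quotient
    (N : Submodule (IwasawaAlgebra p) M) [Module.Finite (IwasawaAlgebra p) (M ⧸ N)]
    [Module.IsTorsionFree (IwasawaAlgebra p) (M ⧸ N)] (hrk : Module.rank (IwasawaAlgebra p) (M ⧸ N) = 1)
    (ψ₁ ψ₂ : M →ₗ[IwasawaAlgebra p] IwasawaAlgebra p)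
    (h₁ : ∀ x ∈ N, ψ₁ x = 0) (h₁' : ∃ x : M, ψ₁ x ∉ IwasawaAlgebra.augIdealP p)
    (h₂ : ∀ x ∈ N, ψ₂ x = 0) (h₂' : ∃ x : M, ψ₂ x ∉ IwasawaAlgebra.augIdealP p) (m : M) :
    ψ₁ m ∉ IwasawaAlgebra.augIdealP p ↔ ψ₂ m ∉ IwasawaAlgebra.augIdealP p := by
  obtain ⟨col, hker, -, -, hsat⟩ := exists_functional_ker_eq_of_isTorsionFree_rank_eq_one_of_moduleFinite_quotient N hrk
  have hker' : ∀ x : M, col x = 0 → x ∈ N := fun x hx => (hker x).mp hx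
  have hprime : (IwasawaAlgebra.augIdealP p).IsPrime := IwasawaAlgebra.isPrime_augIdealP_holds p
  have key : ∀ ψ : M →ₗ[IwasawaAlgebra p] IwasawaAlgebra p, (∀ x ∈ N, ψ x = 0) →
      (∃ x : M, ψ x ∉ IwasawaAlgebra.augIdealP p) →
      (ψ m ∉ IwasawaAlgebra.augIdealP p ↔ col m ∉ IwasawaAlgebra.augIdealP p) := by
    intro ψ hψ hψ'
    obtain ⟨c, hc, -⟩ := exists_unique_eq_smul_of_saturated N col hker' hsat ψ hψ
    obtain ⟨x, hx⟩ := hψ'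
    have hcp : c ∉ IwasawaAlgebra.augIdealP p := fun hcp => hx (by
      rw [hc, LinearMap.smul_apply, smul_eq_mul]
      exact Ideal.mul_mem_right _ _ hcp)
    rw [hc, LinearMap.smul_apply, smul_eq_mul, not_iff_not]
    refine ⟨fun h => (hprime.mem_or_mem h).resolve_left hcp, fun h => Ideal.mul_mem_left _ _ h⟩
  rw [key ψ₁ h₁ h₁', key ψ₂ h₂ h₂']

/-- **Choice-freeness for functionals with kernel INSIDE `N`**, from `Module.Finite Λ (M ⧸ N)` only (`ker ≤ N` upgrades to `ker = N` by w3 g8's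
`apply_eq_zero_of_mem_of_ker_le_of_rank_quotient_eq_one`). [cite: BourbakiAC5to7, Ch. VII §4 nos. 1–2] -/
theorem notMem_augIdealP_iff_of_ker_le_of_moduleFinite_quotient
    (N : Submodule (IwasawaAlgebra p) M) [Module.Finite (IwasawaAlgebra p) (M ⧸ N)]
    [Module.IsTorsionFree (IwasawaAlgebra p) (M ⧸ N)] (hrk : Module.rank (IwasawaAlgebra p) (M ⧸ N) = 1)
    (ψ₁ ψ₂ : M →ₗ[IwasawaAlgebra p] IwasawaAlgebra p)
    (h₁ : ∀ x : M, ψ₁ x = 0 → x ∈ N) (h₁' : ∃ x : M, ψ₁ x ∉ IwasawaAlgebra.augIdealP p)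
    (h₂ : ∀ x : M, ψ₂ x = 0 → x ∈ N) (h₂' : ∃ x : M, ψ₂ x ∉ IwasawaAlgebra.augIdealP p) (m : M) :
    ψ₁ m ∉ IwasawaAlgebra.augIdealP p ↔ ψ₂ m ∉ IwasawaAlgebra.augIdealP p :=
  notMem_augIdealP_iff_of_normalised_of_moduleFinite_quotient N hrk ψ₁ ψ₂
    (apply_eq_zero_of_mem_of_ker_le_of_rank_quotient_eq_one N hrk ψ₁ h₁) h₁'
    (apply_eq_zero_of_mem_of_ker_le_of_rank_quotient_eq_one N hrk ψ₂ h₂) h₂' m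

end FiniteGeneration

/-! ## §2 On Kato's carriers: the transpose of the `Λ`-adic Tate pairing, the coarse quotient inside `X(E/ℚ_∞)`, the cite stub from two print facts -/

section Carriers
section Pins

variable {p : ℕ} [Fact p.Prime]
variable (W : WeierstrassCurve ℚ) [W.IsElliptic] [W.IsGloballyMinimal]
  [ContinuousSMul ℤ_[p] (W.tateModule p)] [Module.Free ℤ_[p] (W.tateModule p)] [Module.Finite ℤ_[p] (W.tateModule p)]
  (κ : ZpExtension ℚ p) (γ : absoluteGaloisGroup ℚ) (hκ : κ.IsCyclotomic) (hγ : κ.IsTopGenerator γ) (hord : IsOrdinaryAt W p)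
  (v : HeightOneSpectrum (𝓞 ℚ)) (hv : ((p : ℕ) : 𝓞 ℚ) ∈ v.asIdeal) (γᵥ : absoluteGaloisGroup (v.adicCompletion ℚ))
  (hsurj : Function.Surjective
    (κ.toContinuousMonoidHom.comp (resGalOfEmb (closureEmb (K := ℚ) (v.adicCompletion ℚ)))))
  (hγᵥ : κ.IsTopGenerator (resGalOfEmb (closureEmb (K := ℚ) (v.adicCompletion ℚ)) γᵥ))
  (I : IwasawaH1Data W p κ γ) (J : LocalIwasawaH1Data κ v ((tateRep W p).toLocal v) γᵥ)
  (J' : LocalIwasawaH1Data κ v (tateLocalOrdinaryRep W p v) γᵥ)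

include hκ hord hv

/-- **The `ι`-semilinear transpose of the `Λ`-adic local Tate pairing, with its kernel** (every `p`; `W/ℚ` globally minimal, good ordinary at `p`;
cyclotomic `κ`, normalised `γ`, `v ∋ p`, normalised local `γᵥ`; all pins `I`, `J`, `J′`; ANY Selmer dual datum `D`).  GRANTED `hPT` there is an
`ι`-SEMILINEAR `F : J.H → D.X` (`IwasawaDual.exists_involSemilinear_transpose_of_T_smul_of_C_smul` on clauses (T)(C) and the dual pair `D`) with kernel
EXACTLY `range(J′.ordinaryInclusion J) ⊔ range(I.loc J)` — `⊆` is clause (E), `⊇` clauses (I)(R): the map `δ` of Kato's (17.13.1) / Greenberg's duality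
before passing to the quotient.  CONDITIONAL on `hPT`.
[cite: Kato2004Asterisque, §17.13 (17.13.1)–(17.13.2) (p. 279)] [cite: GreenbergLNM1716, §4 pp. 121–122] [cite: MilneADT2006, I Thm. 4.10] -/
theorem exists_involSemilinear_transpose_ker_eq_of_poitouTate (hPT : exists_lambdaAdicLocalTatePairing_poitouTate_exact)
    (D : W.SelmerDualData κ γ) :
    ∃ F : J.H →ₛₗ[((IwasawaAlgebra.involEquiv p).toRingEquiv : IwasawaAlgebra p →+* IwasawaAlgebra p)] D.X,
      LinearMap.ker F = LinearMap.range (J'.ordinaryInclusion J) ⊔ LinearMap.range (I.loc J hsurj hγ hγᵥ) := by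
  obtain ⟨toDualP, -, hTcl, hCcl, -, hI, hR, hE⟩ := hPT p W κ γ hκ hγ hord v hv γᵥ hsurj hγᵥ I J J'
  -- the keys: `ψ⁻ = conj_{γ⁻¹} − 1` on `H¹(ℚ_∞, E[p^∞])` (source), `ψ′ = conj_γ − 1` on `Sel` (target), `ψ = conj_γ − 1`
  obtain ⟨ψm, hψm⟩ : ∃ e : AddMonoid.End (W.subgroupH1 p κ.kerSubgroup),
      ∀ s, e s = W.conjH1 p κ.kerSubgroup γ⁻¹ s - s :=
    ⟨W.conjH1 p κ.kerSubgroup γ⁻¹ - AddMonoidHom.id _, fun _ ↦ rfl⟩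
  obtain ⟨ψ, hψ⟩ : ∃ e : AddMonoid.End (W.subgroupH1 p κ.kerSubgroup),
      ∀ s, e s = W.conjH1 p κ.kerSubgroup γ s - s :=
    ⟨W.conjH1 p κ.kerSubgroup γ - AddMonoidHom.id _, fun _ ↦ rfl⟩
  have hT : ∀ (x : J.H) (s : W.subgroupH1 p κ.kerSubgroup),
      toDualP ((PowerSeries.X : IwasawaAlgebra p) • x) s = toDualP x (ψm s) := by
    intro x s
    rw [hψm, map_sub, hTcl]
  have hC : ∀ (c : ℤ_[p]) (x : J.H) (s : W.subgroupH1 p κ.kerSubgroup) (k : ℕ), p ^ k • s = 0 →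
      toDualP (PowerSeries.C c • x) s = (PadicInt.toZModPow k c).val • toDualP x s :=
    fun c x s k hk ↦ hCcl c x s k (by rw [← map_nsmul, hk, map_zero])
  have hconj : ∀ (a b : absoluteGaloisGroup ℚ) (s : W.subgroupH1 p κ.kerSubgroup), a * b = 1 →
      W.conjH1 p κ.kerSubgroup a (W.conjH1 p κ.kerSubgroup b s) = s := by
    intro a b s hab
    rw [← AddMonoidHom.comp_apply, ← W.conjH1_mul_holds p κ.kerSubgroup, hab, W.conjH1_one_holds p κ.kerSubgroup,
      AddMonoidHom.id_apply]
  have hψ₁ : (1 + ψm) * (1 + ψ) = 1 := by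
    refine DFunLike.ext _ _ fun s ↦ ?_
    show s + ψ s + ψm (s + ψ s) = s
    rw [hψ, add_sub_cancel, hψm, hconj _ _ s (inv_mul_cancel γ), add_sub_cancel]
  have hψ₂ : (1 + ψ) * (1 + ψm) = 1 := by
    refine DFunLike.ext _ _ fun s ↦ ?_
    show s + ψm s + ψ (s + ψm s) = s
    rw [hψm, add_sub_cancel, hψ, hconj _ _ s (mul_inv_cancel γ), add_sub_cancel]
  have hφ : ∀ s' : W.selmerInfty κ,
      (W.selmerInfty κ).subtype ((W.conjSelmerInfty κ γ - 1) s') = ψ ((W.selmerInfty κ).subtype s') := by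
    intro s'
    rw [hψ, End_sub_apply, AddMonoid.End.one_apply, map_sub]
    rfl
  obtain ⟨F, hF⟩ := exists_involSemilinear_transpose_of_T_smul_of_C_smul hT hC (D.isDualPair W hγ) ψ hψ₁ hψ₂
    (W.selmerInfty κ).subtype hφ
  refine ⟨F, le_antisymm ?_ ?_⟩
  · intro x hx
    rw [LinearMap.mem_ker] at hx
    have hx' : ∀ s : W.selmerInfty κ, toDualP x s = 0 := fun s ↦ by
      have h := hF x s
      rw [hx, map_zero, AddMonoidHom.zero_apply] at h
      exact h.symm
    obtain ⟨y, g, rfl⟩ := hE x hx'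
    exact Submodule.add_mem_sup ⟨y, rfl⟩ ⟨g, rfl⟩
  · refine sup_le ?_ ?_
    · rintro _ ⟨y, rfl⟩
      rw [LinearMap.mem_ker]
      apply D.bijective.1
      ext s
      rw [hF, map_zero, AddMonoidHom.zero_apply]
      exact hI y s
    · rintro _ ⟨g, rfl⟩
      rw [LinearMap.mem_ker]
      apply D.bijective.1
      ext s
      rw [hF, map_zero, AddMonoidHom.zero_apply]
      exact hR g s

/-- **The coarse quotient embeds `ι`-semilinearly into `X(E/ℚ_∞)`** (the `δ` of `𝐇¹_Γ(T) → 𝐇¹_{loc,Γ}(T)/𝐇¹_{loc,Γ}(F⁺T) →δ X(E/ℚ_∞) → X₀(E/ℚ_∞) → 0`):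
GRANTED `hPT`, an INJECTIVE `ι`-semilinear `δ : J.H ⧸ (range(J′.ordinaryInclusion J) ⊔ range(I.loc J)) → D.X`.  CONDITIONAL on `hPT`.
[cite: Kato2004Asterisque, §17.13 (17.13.1)–(17.13.2) (p. 279)] [cite: GreenbergLNM1716, §4 p. 122] -/
theorem exists_injective_involSemilinear_coarseQuotient_of_poitouTate (hPT : exists_lambdaAdicLocalTatePairing_poitouTate_exact)
    (D : W.SelmerDualData κ γ) :
    ∃ δ : (J.H ⧸ (LinearMap.range (J'.ordinaryInclusion J) ⊔ LinearMap.range (I.loc J hsurj hγ hγᵥ))) →ₛₗ[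
        ((IwasawaAlgebra.involEquiv p).toRingEquiv : IwasawaAlgebra p →+* IwasawaAlgebra p)] D.X,
      Function.Injective δ := by
  obtain ⟨F, hker⟩ := exists_involSemilinear_transpose_ker_eq_of_poitouTate W κ γ hκ hγ hord v hv γᵥ hsurj hγᵥ I J J' hPT D
  refine ⟨Submodule.liftQ _ F hker.ge, ?_⟩
  rw [← LinearMap.ker_eq_bot]
  exact Submodule.ker_liftQ_eq_bot _ _ _ hker.le

/-- **The coarse quotient `𝐇¹_{loc,Γ}(T_pW) ⧸ (range F⁺ ⊔ loc_v 𝐇¹_Γ)` is finitely generated over `Λ`**, GRANTED `hPT`: it maps `ι`-semilinearly with that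
kernel into `X(E/ℚ_∞)` (`nonempty_selmerDualData_holds`), finitely generated by the KERNEL theorem `SelmerDualData.module_finite_holds` (Greenberg p. 60)
over the Noetherian `Λ`; then `IwasawaDual.moduleFinite_quotient_ker_of_isNoetherian`.  CONDITIONAL on `hPT`.
[cite: GreenbergLNM1716, §1 p. 60, §4 p. 122] [cite: Kato2004Asterisque, §17.13 (17.13.1) (p. 279)] -/
theorem moduleFinite_coarseQuotient_of_poitouTate (hPT : exists_lambdaAdicLocalTatePairing_poitouTate_exact) :
    Module.Finite (IwasawaAlgebra p)
      (J.H ⧸ (LinearMap.range (J'.ordinaryInclusion J) ⊔ LinearMap.range (I.loc J hsurj hγ hγᵥ))) := by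
  obtain ⟨D⟩ := W.nonempty_selmerDualData_holds κ γ hγ
  haveI : Module.Finite (IwasawaAlgebra p) D.X := D.module_finite_holds hγ
  haveI : IsNoetherian (IwasawaAlgebra p) D.X := isNoetherian_of_isNoetherianRing_of_finite _ _
  obtain ⟨F, hker⟩ := exists_involSemilinear_transpose_ker_eq_of_poitouTate W κ γ hκ hγ hord v hv γᵥ hsurj hγᵥ I J J' hPT D
  haveI := moduleFinite_quotient_ker_of_isNoetherian F
  exact Module.Finite.equiv (Submodule.quotEquivOfEq _ _ hker)

end Pins

variable {p : ℕ} [Fact p.Prime]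

/-- **The ordinary quotient is finitely generated — in the binder list of the cite stub** (every `p`; no global pin, no `γ`, no structure instances):
GRANTED `hPT`, for all local pins `J`, `J′` at a good ordinary `v ∋ p`, `Q = J.H ⧸ range(J′.ordinaryInclusion J)` is finitely generated over `Λ`: `Q` is
an extension of the coarse quotient (`moduleFinite_coarseQuotient_of_poitouTate`, at the global pin `nonempty_iwasawaH1Data_holds` with `γ := res γᵥ`,
`surjective_comp_resGalOfEmb_of_isCyclotomic`, `module_free/finite_tateModule_holds` — all THEOREMS) by the image of `𝐇¹_Γ(T_pW)`, finitely generated by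
the KERNEL theorem (12.2.1) `IwasawaH1Data.module_finite_of_isCyclotomic` (`Submodule.fg_of_fg_map_of_fg_inf_ker`).  THIS is what (12.2.3) was used for
in `OrdinaryKernelFunctionalOfQuotientRankProofs`.  CONDITIONAL on `hPT`.
[cite: Kato2004Asterisque, §12.2 (12.2.1) (p. 220), §17.13 (17.13.1) (p. 279)] [cite: GreenbergLNM1716, §4 p. 122] [cite: SilvermanAEC2009, Prop. III.7.1] -/
theorem moduleFinite_ordinaryQuotient_of_poitouTate (hPT : exists_lambdaAdicLocalTatePairing_poitouTate_exact)
    (p : ℕ) [Fact p.Prime] (W : WeierstrassCurve ℚ) [W.IsElliptic] [W.IsGloballyMinimal]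
    [ContinuousSMul ℤ_[p] (W.tateModule p)]
    (κ : ZpExtension ℚ p) (v : HeightOneSpectrum (𝓞 ℚ)) (γᵥ : absoluteGaloisGroup (v.adicCompletion ℚ))
    (hκ : κ.IsCyclotomic) (hv : ((p : ℕ) : 𝓞 ℚ) ∈ v.asIdeal) (hord : IsOrdinaryAt W p)
    (hγᵥ : κ.IsTopGenerator (resGalOfEmb (closureEmb (K := ℚ) (v.adicCompletion ℚ)) γᵥ))
    (J : LocalIwasawaH1Data κ v ((tateRep W p).toLocal v) γᵥ)
    (J' : LocalIwasawaH1Data κ v (tateLocalOrdinaryRep W p v) γᵥ) :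
    Module.Finite (IwasawaAlgebra p) (J.H ⧸ LinearMap.range (J'.ordinaryInclusion J)) := by
  haveI : Module.Free ℤ_[p] (W.tateModule p) := WeierstrassCurve.module_free_tateModule_holds W p
  haveI : Module.Finite ℤ_[p] (W.tateModule p) := WeierstrassCurve.module_finite_tateModule_holds W p
  have hsurj := surjective_comp_resGalOfEmb_of_isCyclotomic (κ := κ) (v := v) hκ hv
  obtain ⟨I⟩ := nonempty_iwasawaH1Data_holds W p κ _ hκ hγᵥ
  set N : Submodule (IwasawaAlgebra p) J.H := LinearMap.range (J'.ordinaryInclusion J) with hN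
  set K : Submodule (IwasawaAlgebra p) J.H := N ⊔ LinearMap.range (I.loc J hsurj hγᵥ hγᵥ) with hK
  have hKfin : Module.Finite (IwasawaAlgebra p) (J.H ⧸ K) :=
    moduleFinite_coarseQuotient_of_poitouTate W κ _ hκ hγᵥ hord v hv γᵥ hsurj hγᵥ I J J' hPT
  haveI hIfin : Module.Finite (IwasawaAlgebra p) I.H := IwasawaH1Data.module_finite_of_isCyclotomic hκ hγᵥ I
  have hNK : N ≤ LinearMap.ker K.mkQ := by rw [Submodule.ker_mkQ]; exact le_sup_left
  let f : (J.H ⧸ N) →ₗ[IwasawaAlgebra p] (J.H ⧸ K) := N.liftQ K.mkQ hNK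
  rw [Module.finite_def]
  refine Submodule.fg_of_fg_map_of_fg_inf_ker f ?_ ?_
  · rw [Submodule.map_top, Submodule.range_liftQ, Submodule.range_mkQ]
    exact Module.finite_def.mp hKfin
  · rw [top_inf_eq, Submodule.ker_liftQ, Submodule.ker_mkQ, hK, Submodule.map_sup, Submodule.mkQ_map_self, bot_sup_eq,
      ← LinearMap.range_comp, ← Submodule.map_top]
    exact (Module.finite_def.mp hIfin).map _


/-- **`exists_ordinaryKernelFunctional` (the cite stub `stub_ordKernelFunctional`, p727215) is a THEOREM modulo Poitou–Tate exactness (p729889) and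
the structure fact (p740652) — (12.2.3) NOT needed**: `Q` is finitely generated (`moduleFinite_ordinaryQuotient_of_poitouTate`), torsion-free of rank one
(`hQ`), hence carries a NORMALISED functional with kernel EXACTLY `range(𝐇¹_{loc,Γ}(F⁺T) → 𝐇¹_{loc,Γ}(T))` (§1).  CONDITIONAL on the two named facts.
[cite: Kato2004Asterisque, Prop. 17.11 with proof (p. 277), §17.13 (17.13.1)–(17.13.2) (p. 279)] [cite: PerrinRiou2000JAMS, §1.1 (p. 537)]
[cite: GreenbergLNM1716, §4 pp. 121–122] [cite: BourbakiAC5to7, Ch. VII §4 nos. 1–2] -/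
theorem exists_ordinaryKernelFunctional_of_poitouTate_of_ordinaryQuotientRank
    (hPT : exists_lambdaAdicLocalTatePairing_poitouTate_exact)
    (hQ : localIwasawaH1_ordinaryQuotient_isTorsionFree_rank_eq_one) :
    exists_ordinaryKernelFunctional := by
  intro p _ W _ _ _ κ v γᵥ hκ hv hord hγᵥ J J'
  haveI := moduleFinite_ordinaryQuotient_of_poitouTate hPT p W κ v γᵥ hκ hv hord hγᵥ J J'
  obtain ⟨htf, hrk⟩ := hQ p W κ v γᵥ hκ hv hord hγᵥ J J'
  haveI := htf
  obtain ⟨col, hker, hval, -, -⟩ := exists_functional_ker_eq_of_isTorsionFree_rank_eq_one_of_moduleFinite_quotient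
    (LinearMap.range (J'.ordinaryInclusion J)) hrk
  exact ⟨col, hker, hval⟩

/-- **The finite-cokernel, saturated ordinary-kernel functional (the shape of Kato's Prop. 17.11), modulo `hPT` + `hQ`** — (12.2.3) NOT needed: on
all pinned carriers at a good ordinary `v ∣ p` (every `p`) there is `col : 𝐇¹_{loc,Γ}(T_pW) → Λ` with kernel EXACTLY `range(𝐇¹_{loc,Γ}(F⁺T))`, a value
outside `(p)`, range of FINITE index and saturated range. [cite: Kato2004Asterisque, Prop. 17.11 with proof (p. 277), 13.14 (p. 234)]
[cite: BourbakiAC5to7, Ch. VII §4 no. 2] -/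
theorem exists_saturated_ordinaryKernelFunctional_of_poitouTate_of_ordinaryQuotientRank
    (hPT : exists_lambdaAdicLocalTatePairing_poitouTate_exact)
    (hQ : localIwasawaH1_ordinaryQuotient_isTorsionFree_rank_eq_one) :
    ∀ (p : ℕ) [Fact p.Prime] (W : WeierstrassCurve ℚ) [W.IsElliptic] [W.IsGloballyMinimal]
      [ContinuousSMul ℤ_[p] (W.tateModule p)]
      (κ : ZpExtension ℚ p) (v : HeightOneSpectrum (𝓞 ℚ)) (γᵥ : absoluteGaloisGroup (v.adicCompletion ℚ)),
      κ.IsCyclotomic → ((p : ℕ) : 𝓞 ℚ) ∈ v.asIdeal → IsOrdinaryAt W p →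
      κ.IsTopGenerator (resGalOfEmb (closureEmb (K := ℚ) (v.adicCompletion ℚ)) γᵥ) →
      ∀ (J : LocalIwasawaH1Data κ v ((tateRep W p).toLocal v) γᵥ)
        (J' : LocalIwasawaH1Data κ v (tateLocalOrdinaryRep W p v) γᵥ),
      ∃ col : J.H →ₗ[IwasawaAlgebra p] IwasawaAlgebra p,
        (∀ x : J.H, col x = 0 ↔ x ∈ LinearMap.range (J'.ordinaryInclusion J)) ∧
          (∃ x : J.H, col x ∉ IwasawaAlgebra.augIdealP p) ∧
          Finite (IwasawaAlgebra p ⧸ LinearMap.range col) ∧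
          (∀ π : IwasawaAlgebra p, ¬ IsUnit π → ¬ (LinearMap.range col ≤ Ideal.span {π})) := by
  intro p _ W _ _ _ κ v γᵥ hκ hv hord hγᵥ J J'
  haveI := moduleFinite_ordinaryQuotient_of_poitouTate hPT p W κ v γᵥ hκ hv hord hγᵥ J J'
  obtain ⟨htf, hrk⟩ := hQ p W κ v γᵥ hκ hv hord hγᵥ J J'
  haveI := htf
  exact exists_functional_ker_eq_of_isTorsionFree_rank_eq_one_of_moduleFinite_quotient
    (LinearMap.range (J'.ordinaryInclusion J)) hrk

/-- **«`col x ∉ (p)`» does not depend on the normalised ordinary-kernel functional**, modulo `hPT` + `hQ` ((12.2.3) NOT needed): on all pinned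
carriers at a good ordinary `v ∣ p`, two `Λ`-linear `col₁, col₂ : 𝐇¹_{loc,Γ}(T_pW) → Λ` vanishing on `range(𝐇¹_{loc,Γ}(F⁺T))`, each with some value
outside `(p)`, satisfy `col₁ x ∉ (p) ↔ col₂ x ∉ (p)` for every class `x`. [cite: Kato2004Asterisque, Prop. 17.11 (p. 277)] [cite: BourbakiAC5to7, Ch. VII §4 no. 2] -/
theorem ordinaryKernelFunctional_notMem_iff_of_poitouTate_of_ordinaryQuotientRank
    (hPT : exists_lambdaAdicLocalTatePairing_poitouTate_exact)
    (hQ : localIwasawaH1_ordinaryQuotient_isTorsionFree_rank_eq_one)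
    {p : ℕ} [Fact p.Prime] (W : WeierstrassCurve ℚ) [W.IsElliptic] [W.IsGloballyMinimal]
    [ContinuousSMul ℤ_[p] (W.tateModule p)]
    {κ : ZpExtension ℚ p} {v : HeightOneSpectrum (𝓞 ℚ)} {γᵥ : absoluteGaloisGroup (v.adicCompletion ℚ)}
    (hκ : κ.IsCyclotomic) (hv : ((p : ℕ) : 𝓞 ℚ) ∈ v.asIdeal) (hord : IsOrdinaryAt W p)
    (hγᵥ : κ.IsTopGenerator (resGalOfEmb (closureEmb (K := ℚ) (v.adicCompletion ℚ)) γᵥ))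
    (J : LocalIwasawaH1Data κ v ((tateRep W p).toLocal v) γᵥ)
    (J' : LocalIwasawaH1Data κ v (tateLocalOrdinaryRep W p v) γᵥ)
    (col₁ col₂ : J.H →ₗ[IwasawaAlgebra p] IwasawaAlgebra p)
    (h₁ : ∀ y : J'.H, col₁ (J'.ordinaryInclusion J y) = 0) (h₁' : ∃ x : J.H, col₁ x ∉ IwasawaAlgebra.augIdealP p)
    (h₂ : ∀ y : J'.H, col₂ (J'.ordinaryInclusion J y) = 0) (h₂' : ∃ x : J.H, col₂ x ∉ IwasawaAlgebra.augIdealP p)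
    (x : J.H) :
    col₁ x ∉ IwasawaAlgebra.augIdealP p ↔ col₂ x ∉ IwasawaAlgebra.augIdealP p := by
  haveI := moduleFinite_ordinaryQuotient_of_poitouTate hPT p W κ v γᵥ hκ hv hord hγᵥ J J'
  obtain ⟨htf, hrk⟩ := hQ p W κ v γᵥ hκ hv hord hγᵥ J J'
  haveI := htf
  refine notMem_augIdealP_iff_of_normalised_of_moduleFinite_quotient (LinearMap.range (J'.ordinaryInclusion J)) hrk col₁ col₂
    ?_ h₁' ?_ h₂' x
  · rintro _ ⟨y, rfl⟩
    exact h₁ y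
  · rintro _ ⟨y, rfl⟩
    exact h₂ y

/-- **The `ker ≤ range` version of choice-freeness, modulo `hPT` + `hQ`** ((12.2.3) NOT needed): for two `Λ`-linear `col₁, col₂ : 𝐇¹_{loc,Γ}(T_pW) → Λ`
with `ker colᵢ ≤ range(𝐇¹_{loc,Γ}(F⁺T))`, each with some value outside `(p)`, and every class `x`: `col₁ x ∉ (p) ↔ col₂ x ∉ (p)` — the `∃ col`
value texts V∓ and the `∀ col` registered texts V♭∓ of the line agree modulo the two facts. [cite: Kato2004Asterisque, Prop. 17.11 (p. 277)]
[cite: BourbakiAC5to7, Ch. VII §4 nos. 1–2] -/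
theorem ordinaryKernelFunctional_notMem_iff_of_ker_le_of_poitouTate_of_ordinaryQuotientRank
    (hPT : exists_lambdaAdicLocalTatePairing_poitouTate_exact)
    (hQ : localIwasawaH1_ordinaryQuotient_isTorsionFree_rank_eq_one)
    {p : ℕ} [Fact p.Prime] (W : WeierstrassCurve ℚ) [W.IsElliptic] [W.IsGloballyMinimal]
    [ContinuousSMul ℤ_[p] (W.tateModule p)]
    {κ : ZpExtension ℚ p} {v : HeightOneSpectrum (𝓞 ℚ)} {γᵥ : absoluteGaloisGroup (v.adicCompletion ℚ)}
    (hκ : κ.IsCyclotomic) (hv : ((p : ℕ) : 𝓞 ℚ) ∈ v.asIdeal) (hord : IsOrdinaryAt W p)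
    (hγᵥ : κ.IsTopGenerator (resGalOfEmb (closureEmb (K := ℚ) (v.adicCompletion ℚ)) γᵥ))
    (J : LocalIwasawaH1Data κ v ((tateRep W p).toLocal v) γᵥ)
    (J' : LocalIwasawaH1Data κ v (tateLocalOrdinaryRep W p v) γᵥ)
    (col₁ col₂ : J.H →ₗ[IwasawaAlgebra p] IwasawaAlgebra p)
    (h₁ : ∀ x : J.H, col₁ x = 0 → x ∈ LinearMap.range (J'.ordinaryInclusion J))
    (h₁' : ∃ x : J.H, col₁ x ∉ IwasawaAlgebra.augIdealP p)
    (h₂ : ∀ x : J.H, col₂ x = 0 → x ∈ LinearMap.range (J'.ordinaryInclusion J))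
    (h₂' : ∃ x : J.H, col₂ x ∉ IwasawaAlgebra.augIdealP p) (x : J.H) :
    col₁ x ∉ IwasawaAlgebra.augIdealP p ↔ col₂ x ∉ IwasawaAlgebra.augIdealP p := by
  haveI := moduleFinite_ordinaryQuotient_of_poitouTate hPT p W κ v γᵥ hκ hv hord hγᵥ J J'
  obtain ⟨htf, hrk⟩ := hQ p W κ v γᵥ hκ hv hord hγᵥ J J'
  haveI := htf
  exact notMem_augIdealP_iff_of_ker_le_of_moduleFinite_quotient (LinearMap.range (J'.ordinaryInclusion J)) hrk col₁ col₂ h₁ h₁' h₂ h₂' x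

end Carriers

end Literature.NumberTheory.EllipticCurves.Kato2004

end
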